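import Summits.QuantumAdvantage.QuantumAdvantage.Theorems.WbwObfuscatedGluedTreesKowGenCoherent
import HarnessLib

/-!
# Toolkit stub `toolkit_oracle` — the glued-trees ORACLE on codes (crux `WbwObfuscatedGluedTrees`,
# stmt-QuantumAdvantage-2340; line `knowledge-of-walk-split`, stage 3, piece G5 of `NbrBitFP`)

On the code of `(1^μ, 1^d, k₁, k₂, k₃, k₄, y)` (`d ≥ 1`) the sorted list of the names of the neighbours of
the vertex named by the first `N = nameLen μ d` bits of `y` — the tree's
`gluedTreesOracle (cycleOf P μ k₃ k₄ d) (naming P μ k₁ k₂ d) (vecOf N y)`, listed as strings — is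
computed by an `FP` string function, GIVEN the four sibling statements as hypotheses: SIV encryption (G1a), SIV un-naming
(G1b), the neighbour labels of a vertex (G3) and insertion sort by binary value (G4).

Algorithm: `y' = fit N y`; `u = G1b (μ, k₁, k₂, d, y')` (`= 1 :: label d v` if `y'` names `v`, else `ε`);
the label fed to G3 is `fit (2d+3) (u ⇂ 1)` — the label of the named vertex, or of the ENTRANCE when `u = ε`,
so that G3 (specified on genuine vertex codes only) is always queried on a genuine code; its labels are
encrypted by G1a (`CodeFP.map`) and sorted by G4; the answer is `[]` when `u = ε` or `d = 0`.
Correctness: G3 lists the neighbourhood without repetition (`neighborFinset_of_depth_lt/_eq`), the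
neighbour-name set at `ν v` is the image of the neighbourhood (`nbrNames_naming`), `bitsToNat ∘ List.ofFn =
nameVal`, and a duplicate-free list sorted by an order is the `Finset.sort` of its set (`List.toFinset_sort`,
`List.map_insertionSort`).

## References

* [ChildsEtAl2003] A. M. Childs et al., *Exponential algorithmic speedup by a quantum walk*, STOC 2003, §2
  and §4 Game 1 (names, the oracle listing the neighbour names).
* [AroraBarak2009] S. Arora, B. Barak, *Computational Complexity*, CUP 2009, §1.3 (closure of polynomial time).
-/

set_option linter.dupNamespace false

noncomputable section

namespace Summit.QuantumAdvantage.QuantumAdvantage.Theorems.WbwObfuscatedGluedTrees.KnowledgeOfWalk.Generator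

open Literature.Computability.Cryptography Literature.Computability.Complexity
open Literature.Computability.Cryptography.ObfuscatedGluedTrees
open Literature.Computability.QuantumComplexity
open Literature.Computability.Complexity.CodeFP (natE unE bitE pairE strE rawE)
open Literature.Computability.QuantumComplexity.GluedTrees (Vertex CycleDatum nameVal nameOfVal nbrNames graph
  depth parentV childV cross₁ cross₂ nameOfVal_nameVal nameVal_injective neighborFinset_of_depth_lt
  neighborFinset_of_depth_eq cross₁_ne_cross₂ parentV_ne_cross₁ parentV_ne_cross₂ childV_false_ne_true
  depth_childV depth_parentV depth_le)

/-! ### Binary values, fitted strings -/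

/-- `bitsToNat (List.ofFn a) = nameVal a` (both little-endian). [folklore] -/
private theorem orc_bitsToNat_ofFn : ∀ {N : ℕ} (a : Fin N → Bool), bitsToNat (List.ofFn a) = nameVal a
  | 0, a => by simp [nameVal]
  | N + 1, a => by
    rw [List.ofFn_succ, bitsToNat_cons, orc_bitsToNat_ofFn, nameVal, nameVal, Fin.sum_univ_succ]
    simp only [Fin.val_zero, pow_zero, mul_one, Fin.val_succ, pow_succ, Finset.mul_sum]
    congr 1
    exact Finset.sum_congr rfl fun i _ => by ring

/-- The first `N` bits of `y` (zero-padded), listed, are `fit N y`. [folklore] -/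
private theorem orc_ofFn_vecOf (N : ℕ) (y : List Bool) : List.ofFn (vecOf N y) = fit N y := by
  apply List.ext_getElem (by simp) fun i h₁ h₂ => ?_
  have hi : i < N := by simpa using h₁
  simp only [List.getElem_ofFn, vecOf, fit, List.getElem_take, List.getD_eq_getElem?_getD,
    List.getElem_append]
  split_ifs with h
  · rw [List.getElem?_eq_getElem h]; rfl
  · rw [List.getElem?_eq_none (not_lt.mp h), List.getElem_replicate]; rfl

/-- `vecOf N` only reads `fit N y`. [folklore] -/
private theorem orc_vecOf_fit (N : ℕ) (y : List Bool) : vecOf N (fit N y) = vecOf N y :=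
  List.ofFn_injective (by rw [orc_ofFn_vecOf, orc_ofFn_vecOf, fit_of_length_eq (length_fit _ _)])

/-! ### The neighbourhood list of G3 -/

variable {d : ℕ}

/-- G3's vertex list enumerates the neighbourhood of `v` without repetition (`1 ≤ d`).
[cite: ChildsEtAl2003, §2] -/
private theorem orc_nbrList (hd : 1 ≤ d) (σ : CycleDatum d) (v : Vertex d) :
    ((if depth v = 0 then [] else [parentV v]) ++
        (if depth v < d then [childV v false, childV v true] else [cross₁ σ v, cross₂ σ v])).toFinset =
      (graph d σ).neighborFinset v ∧
    ((if depth v = 0 then [] else [parentV v]) ++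
        (if depth v < d then [childV v false, childV v true] else [cross₁ σ v, cross₂ σ v])).Nodup := by
  by_cases hv : depth v < d
  · have hpc : ∀ b, parentV v ≠ childV v b := fun b h => by
      have := congrArg depth h; rw [depth_childV hv, depth_parentV] at this; omega
    have hcc := childV_false_ne_true hv
    rw [neighborFinset_of_depth_lt σ hv, if_pos hv]
    by_cases h0 : depth v = 0
    · rw [if_pos h0, if_pos h0]; simp [hcc]
    · rw [if_neg h0, if_neg h0]; simp [hcc, hpc]; exact Finset.insert_comm _ _ _
  · have hv' : depth v = d := le_antisymm (depth_le v) (not_lt.mp hv)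
    have h12 := cross₁_ne_cross₂ hd σ hv'
    have hp1 := parentV_ne_cross₁ (σ := σ) hv'
    have hp2 := parentV_ne_cross₂ (σ := σ) hv'
    have h0 : depth v ≠ 0 := by omega
    rw [neighborFinset_of_depth_eq hd σ hv', if_neg hv, if_neg h0]
    simp [h12, hp1, hp2]

/-! ### Sorting names by value -/

/-- A duplicate-free list of vertices, named and insertion-sorted by binary value, is the `nameVal`-sorted
enumeration of the name set read back as strings (the shape of `gluedTreesOracle`). [folklore] -/
private theorem orc_sort_names {α : Type} [DecidableEq α] {N : ℕ} (ν : α ↪ (Fin N → Bool)) {L : List α}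
    (hL : L.Nodup) :
    (L.map fun w => List.ofFn (ν w)).insertionSort (fun a b => bitsToNat a ≤ bitsToNat b) =
      (((L.toFinset.map ν).image nameVal).sort (· ≤ ·)).map fun m => List.ofFn (nameOfVal N m) := by
  set g : ℕ → List Bool := fun m => List.ofFn (nameOfVal N m) with hg
  set val : α → ℕ := fun w => nameVal (ν w) with hval
  have hinj : Function.Injective val := fun a b h => ν.injective (nameVal_injective h)
  have h1 : (L.map fun w => List.ofFn (ν w)) = (L.map val).map g := by
    rw [List.map_map]
    exact List.map_congr_left fun w _ => by simp [hg, hval, nameOfVal_nameVal]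
  have h2 : ((L.map val).insertionSort (· ≤ ·)).map g =
      ((L.map val).map g).insertionSort (fun a b => bitsToNat a ≤ bitsToNat b) :=
    List.map_insertionSort (r := (· ≤ ·)) (s := fun a b => bitsToNat a ≤ bitsToNat b) g _ fun a ha b hb => by
      obtain ⟨w, -, rfl⟩ := List.mem_map.1 ha
      obtain ⟨w', -, rfl⟩ := List.mem_map.1 hb
      simp [hg, hval, nameOfVal_nameVal, orc_bitsToNat_ofFn]
  have hnd : ((L.map val).insertionSort (· ≤ ·)).Nodup :=
    (List.perm_insertionSort _ _).nodup_iff.2 (hL.map hinj)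
  have hT : ((L.map val).insertionSort (· ≤ ·)).toFinset = (L.toFinset.map ν).image nameVal := by
    ext m
    simp [hval, List.mem_insertionSort]
  rw [h1, ← h2, ← hT]
  exact congrArg _ ((List.toFinset_sort (r := (· ≤ ·)) hnd).2 (List.pairwise_insertionSort _ _)).symm

/-! ### The oracle at honest and at dishonest names -/

variable (P : PuncturablePRFScheme)

/-- At a string naming no vertex the oracle lists nothing. [cite: ChildsEtAl2003, §4 Game 1] -/
private theorem orc_oracle_none (σ : CycleDatum d) {μ : ℕ} {k₁ k₂ y : List Bool}
    (h : ∀ v, vname P μ k₁ k₂ d v ≠ fit (nameLen μ d) y) :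
    gluedTreesOracle σ (naming P μ k₁ k₂ d) (vecOf (nameLen μ d) y) = [] := by
  have hfil : (Finset.univ.filter fun w => naming P μ k₁ k₂ d w = vecOf (nameLen μ d) y) = ∅ :=
    Finset.filter_eq_empty_iff.2 fun w _ hw => h w (by rw [← ofFn_naming, hw, orc_ofFn_vecOf])
  unfold gluedTreesOracle GluedTrees.nbrNames
  rw [hfil, Finset.biUnion_empty, Finset.image_empty, Finset.sort_empty, List.map_nil]

/-- At the name of `v` the oracle, listed as strings, is the insertion sort by binary value of the names of
G3's neighbour list of `v`. [cite: ChildsEtAl2003, §2 and §4 Game 1] -/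
private theorem orc_oracle_some (hd : 1 ≤ d) (σ : CycleDatum d) {μ : ℕ} {k₁ k₂ y : List Bool} {v : Vertex d}
    (hv : vname P μ k₁ k₂ d v = fit (nameLen μ d) y) :
    (gluedTreesOracle σ (naming P μ k₁ k₂ d) (vecOf (nameLen μ d) y)).map List.ofFn =
      ((((if depth v = 0 then [] else [parentV v]) ++
          (if depth v < d then [childV v false, childV v true] else [cross₁ σ v, cross₂ σ v])).map
          (label d)).map fun a => sivEnc P μ k₁ k₂ a).insertionSort
        fun a b => bitsToNat a ≤ bitsToNat b := by
  have hνv : naming P μ k₁ k₂ d v = vecOf (nameLen μ d) y := by rw [← vecOf_vname, hv, orc_vecOf_fit]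
  obtain ⟨hT, hnd⟩ := orc_nbrList hd σ v
  rw [← hνv, gluedTreesOracle, nbrNames_naming, ← hT, List.map_map, List.map_map,
    List.map_congr_left (f := (fun a => sivEnc P μ k₁ k₂ a) ∘ label d)
      (g := fun w => List.ofFn (naming P μ k₁ k₂ d w)) fun w _ => (ofFn_naming P μ k₁ k₂ d w).symm,
    orc_sort_names _ hnd]
  rfl

/-- The label handed to G3: `fit (2d+3) (u ⇂ 1)` is the label of the named vertex, or of the ENTRANCE when
the un-naming string `u` is empty. [folklore] -/
private theorem orc_lab_eq (o : Option (Vertex d)) :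
    fit (labelLen d) (((o.map fun v => true :: label d v).getD []).drop 1) =
      label d (o.getD (GluedTrees.entrance d)) := by
  cases o with
  | none => simp [fit, FPData.label_entrance]
  | some v => simp [fit_of_length_eq (length_label v)]

/-- **Pointwise correctness of the assembled program**: with `v₀` the named vertex (or the ENTRANCE), the
guarded, emptiness-tested, sorted encryption of G3's labels is the registered oracle map.
[cite: ChildsEtAl2003, §4 Game 1] -/
private theorem orc_pointwise (μ d : ℕ) (k₁ k₂ k₃ k₄ y : List Bool) (v₀ : Vertex d)
    (hv₀ : v₀ = (unname P μ k₁ k₂ d (fit (nameLen μ d) y)).getD (GluedTrees.entrance d)) :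
    (if (!decide (d = 0)) = true then
      (if decide (((unname P μ k₁ k₂ d (fit (nameLen μ d) y)).map fun v => true :: label d v).getD [] = [])
          = true then []
       else ((((if depth v₀ = 0 then [] else [parentV v₀]) ++
          (if depth v₀ < d then [childV v₀ false, childV v₀ true]
           else [cross₁ (cycleOf P μ k₃ k₄ d) v₀, cross₂ (cycleOf P μ k₃ k₄ d) v₀])).map (label d)).map
            fun a => sivEnc P μ k₁ k₂ a).insertionSort fun a b => bitsToNat a ≤ bitsToNat b)
     else []) =
    if 1 ≤ d then
      (gluedTreesOracle (cycleOf P μ k₃ k₄ d) (naming P μ k₁ k₂ d) (vecOf (nameLen μ d) y)).map List.ofFn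
    else [] := by
  by_cases hd : 1 ≤ d
  · have hd0 : d ≠ 0 := by omega
    rw [if_pos hd, if_pos (by simp [hd0])]
    rcases huo : unname P μ k₁ k₂ d (fit (nameLen μ d) y) with _ | v
    · rw [orc_oracle_none P _ ((unname_eq_none_iff P μ k₁ k₂ d _).1 huo)]
      simp
    · rw [orc_oracle_some P hd _ ((unname_eq_some_iff P μ k₁ k₂ d _ v).1 huo), hv₀, huo]
      simp
  · have h0 : d = 0 := by omega
    subst h0
    simp

/-! ### The program on codes -/

/-- **TOOLKIT G5 — the glued-trees ORACLE on codes**: `(1^μ, 1^d, k₁, k₂, k₃, k₄, y) ↦` the sorted list of the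
neighbour names of the vertex named by (the first `N` bits of) `y`, `[]` if none — the tree's
`gluedTreesOracle σ ν (vecOf N y)` listed as strings (`d ≥ 1`) —, computed on codes by an `FP` string function,
from the sibling statements G1a (SIV encryption), G1b (SIV un-naming), G3 (neighbour labels) and G4 (sorting)
taken as hypotheses. [cite: ChildsEtAl2003, §2 and §4 Game 1] -/
theorem toolkit_oracle :
    ∀ (P : PuncturablePRFScheme),
      Literature.Computability.Complexity.CodeFP (pairE unE (pairE strE strE)) strE
        (fun p : ℕ × List Bool × List Bool => P.eval p.1 p.2.1 p.2.2) →
      Literature.Computability.Complexity.CodeFP (pairE unE (pairE strE (pairE strE strE))) strE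
        (fun t : ℕ × List Bool × List Bool × List Bool => sivEnc P t.1 t.2.1 t.2.2.1 t.2.2.2) →
      Literature.Computability.Complexity.CodeFP (pairE unE (pairE strE (pairE strE (pairE unE strE)))) strE
        (fun t : ℕ × List Bool × List Bool × ℕ × List Bool =>
          ((unname P t.1 t.2.1 t.2.2.1 t.2.2.2.1 t.2.2.2.2).map fun v => true :: label t.2.2.2.1 v).getD []) →
      Literature.Computability.Complexity.CodeFP
        (fun t : ℕ × (Σ d : ℕ, List Bool × List Bool × GluedTrees.Vertex d) =>
          boolPair (unE t.1) (boolPair (unE t.2.1) (boolPair t.2.2.1 (boolPair t.2.2.2.1 (label t.2.1 t.2.2.2.2)))))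
        (rawE strE)
        (fun t : ℕ × (Σ d : ℕ, List Bool × List Bool × GluedTrees.Vertex d) =>
          ((if GluedTrees.depth t.2.2.2.2 = 0 then [] else [GluedTrees.parentV t.2.2.2.2]) ++
            (if GluedTrees.depth t.2.2.2.2 < t.2.1 then
              [GluedTrees.childV t.2.2.2.2 false, GluedTrees.childV t.2.2.2.2 true]
             else [GluedTrees.cross₁ (cycleOf P t.1 t.2.2.1 t.2.2.2.1 t.2.1) t.2.2.2.2,
                   GluedTrees.cross₂ (cycleOf P t.1 t.2.2.1 t.2.2.2.1 t.2.1) t.2.2.2.2])).map (label t.2.1)) →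
      Literature.Computability.Complexity.CodeFP (rawE strE) (rawE strE)
        (fun L : List (List Bool) => L.insertionSort fun a b => bitsToNat a ≤ bitsToNat b) →
      Literature.Computability.Complexity.CodeFP
        (pairE unE (pairE unE (pairE strE (pairE strE (pairE strE (pairE strE strE))))))
        (rawE strE)
        (fun t : ℕ × ℕ × List Bool × List Bool × List Bool × List Bool × List Bool =>
          if 1 ≤ t.2.1 then
            (gluedTreesOracle (cycleOf P t.1 t.2.2.2.2.1 t.2.2.2.2.2.1 t.2.1) (naming P t.1 t.2.2.1 t.2.2.2.1 t.2.1)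
              (vecOf (nameLen t.1 t.2.1) t.2.2.2.2.2.2)).map List.ofFn
          else []) := by
  intro P _ h1a h1b h3 h4
  -- the projections of `t = (μ, d, k₁, k₂, k₃, k₄, y)`
  have pμ := CodeFP.fst unE (pairE unE (pairE strE (pairE strE (pairE strE (pairE strE strE)))))
  have pr := CodeFP.snd unE (pairE unE (pairE strE (pairE strE (pairE strE (pairE strE strE)))))
  have pd := pr.fst'
  have pk₁ := pr.snd'.fst'
  have pk₂ := pr.snd'.snd'.fst'
  have pk₃ := pr.snd'.snd'.snd'.fst'
  have pk₄ := pr.snd'.snd'.snd'.snd'.fst'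
  have py := pr.snd'.snd'.snd'.snd'.snd'
  -- `labelLen d`, `N = nameLen μ d` in unary; the fitted query and its un-naming string `u` (G1b)
  have hLL : CodeFP _ unE (fun t : ℕ × ℕ × List Bool × List Bool × List Bool × List Bool × List Bool =>
      labelLen t.2.1) :=
    (CodeFP.unSucc.comp (CodeFP.unSucc.comp (CodeFP.unSucc.comp ((CodeFP.unMulConst 2).comp pd)))).congr
      fun t => by simp [labelLen]
  have hN : CodeFP _ unE (fun t : ℕ × ℕ × List Bool × List Bool × List Bool × List Bool × List Bool =>
      nameLen t.1 t.2.1) := (CodeFP.unAdd.comp (pμ.pair hLL)).congr fun _ => rfl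
  have hu : CodeFP _ strE (fun t : ℕ × ℕ × List Bool × List Bool × List Bool × List Bool × List Bool =>
      ((unname P t.1 t.2.2.1 t.2.2.2.1 t.2.1 (fit (nameLen t.1 t.2.1) t.2.2.2.2.2.2)).map
        fun v => true :: label t.2.1 v).getD []) :=
    h1b.comp (pμ.pair (pk₁.pair (pk₂.pair (pd.pair (FPData.fitFP.comp (hN.pair py))))))
  -- the label of `v₀` (the named vertex, or the ENTRANCE) and G3's neighbour labels of `v₀`
  have hlab : CodeFP _ strE (fun t : ℕ × ℕ × List Bool × List Bool × List Bool × List Bool × List Bool =>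
      fit (labelLen t.2.1) ((((unname P t.1 t.2.2.1 t.2.2.2.1 t.2.1 (fit (nameLen t.1 t.2.1) t.2.2.2.2.2.2)).map
        fun v => true :: label t.2.1 v).getD []).drop 1)) :=
    FPData.fitFP.comp (hLL.pair (CodeFP.strDrop.comp ((CodeFP.const _ 1).pair hu)))
  have hLv := h3.comp ((pμ.pair (pd.pair (pk₃.pair (pk₄.pair hlab)))).recodeOut
    (g' := fun t : ℕ × ℕ × List Bool × List Bool × List Bool × List Bool × List Bool =>
      ((t.1, ⟨t.2.1, t.2.2.2.2.1, t.2.2.2.2.2.1,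
        (unname P t.1 t.2.2.1 t.2.2.2.1 t.2.1 (fit (nameLen t.1 t.2.1) t.2.2.2.2.2.2)).getD
          (GluedTrees.entrance t.2.1)⟩) : ℕ × Σ d : ℕ, List Bool × List Bool × GluedTrees.Vertex d))
    fun t => by simp only [CodeFP.pairE_apply, orc_lab_eq]; rfl)
  -- encrypt the labels (G1a under `CodeFP.map`, context `(μ, k₁, k₂)`), sort (G4), guard
  have hg : CodeFP (pairE (pairE unE (pairE strE strE)) strE) strE
      (fun q : (ℕ × List Bool × List Bool) × List Bool => sivEnc P q.1.1 q.1.2.1 q.1.2.2 q.2) :=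
    h1a.comp ((CodeFP.fst _ _).fst'.pair ((CodeFP.fst _ _).snd'.fst'.pair
      ((CodeFP.fst _ _).snd'.snd'.pair (CodeFP.snd _ _))))
  have hsorted := h4.comp ((CodeFP.map hg).comp ((pμ.pair (pk₁.pair pk₂)).pair hLv))
  have hnil := (CodeFP.eq (eα := strE) fun _ _ h => h).comp (hu.pair (CodeFP.const _ ([] : List Bool)))
  have hpos := ((CodeFP.eq CodeFP.unE_injective).comp (pd.pair (CodeFP.const _ (0 : ℕ)))).not
  refine ((hpos.ite (hnil.ite (CodeFP.const _ ([] : List (List Bool))) hsorted)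
    (CodeFP.const _ ([] : List (List Bool)))).congr fun t => ?_)
  exact orc_pointwise P t.1 t.2.1 t.2.2.1 t.2.2.2.1 t.2.2.2.2.1 t.2.2.2.2.2.1 t.2.2.2.2.2.2 _ rfl

end Summit.QuantumAdvantage.QuantumAdvantage.Theorems.WbwObfuscatedGluedTrees.KnowledgeOfWalk.Generator

end
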